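import Mathlib
import HarnessLib
import Summits.HubbardSuperconductivity.HubbardSuperconductivity.Theorems.KLProgrammeKLRegimeVolumeLimitTwoPointTimeReduction

/-!
# Child `KLRegimeVolumeLimitV12` (stmt-HubbardSuperconductivity-19858), stub `stub_vl_bound`, input (H1): the GENERIC ASSEMBLY WRAPPER — from a
# two-time Dyson series with CONTINUOUS coefficient densities and an a.e. pointwise match on the marked pieces to the τ-resolved
# identification of the Grassmann two-point limit series (seat hubbard-kl-k3c4-p2, g3; «Matsubara all-U route (R-a)»)

Continuation of `…VolumeLimitTwoPointTimeReduction` (`twoPointTime_term_eq_sum_marked`: the Grassmann order-`n` term of the two-point limit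
series at external times `(s,0)` as `Uⁿ(−β)ⁿ Σ_{k+j=n} ∫_{Δ_k(1−s/β)}∫_{Δ_j(1−(1−s/β))} Σ_x D_s`).  Here the Hamiltonian side is taken ABSTRACTLY:
a family of jointly continuous densities `Φ k j : ℝ^k × ℝ^j → ℂ` whose two-time Dyson series
`Σ_N U^N Σ_{k+j=N} I_k(u ↦ I_j(u′ ↦ Φ k j u u′)(1−(1−s/β)))(1−s/β)` sums to `V` (for the Hubbard torus this is k3c5-p1's
`hasSum_hubbard_twoPoint_twoTime_renormalised_trace`, p484918, with `Φ` the `(−β)^{k+j}`-weighted free trace of the two-time word, or its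
Wick-determinant form C2), and an a.e. POINTWISE MATCH on every marked piece,
`(−β)^{k+j} · Z₀ · Σ_x D_s(x, β(1 − (u ⧺ ((1−s/β)+u′)))) = Φ k j u u′` (k3c5-p1's C2 + entry dictionary).  Then

* **`hasSum_twoPointTime_of_ae_match`** — `HasSum (n ↦ ((−1)ⁿ/n!)·Uⁿ·Σ_x∫_{[0,β]ⁿ} D_s) (V / Z₀)`,

i.e. (H1) `hasSum_twoPointLimitDet_series_time` modulo the pointwise algebra, with all integral plumbing (scaling, reflection, symmetrisation,
marked split, ordered ↔ simplex set integrals for continuous densities, a.e. congruences) discharged here.  Tools: `ae_congr_nested_setIntegral`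
(nested a.e. match ⇒ equality of nested set integrals), `orderedIntegral₂_eq_setIntegral₂` (nested ordered integrals of a jointly continuous
density = nested simplex set integrals).  Everything is proved; no definition.
-/

namespace Summit.HubbardSuperconductivity.HubbardSuperconductivity.Theorems.MatsubaraAllU

set_option linter.dupNamespace false -- summit = problem name (single-conjunct summit), D-0017

open MeasureTheory Finset Filter Topology Literature.MathematicalPhysics.QuantumLattice
  Literature.Probability.LatticeModels
open Literature.MathematicalPhysics.QuantumLattice.GrassmannAlgebra
open scoped Nat ComplexOrder

noncomputable section

/-! ### §1 Two generic integral tools -/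

/-- **Nested ordered integrals of a jointly continuous density are nested simplex set integrals** (`0 ≤ a`, `0 ≤ b`):
`I_k(u ↦ I_j(u′ ↦ Φ u u′) b) a = ∫_{u ∈ Δ_k(a)} ∫_{u′ ∈ Δ_j(b)} Φ u u′`. -/
theorem orderedIntegral₂_eq_setIntegral₂ {k j : ℕ} (Φ : (Fin k → ℝ) → (Fin j → ℝ) → ℂ) (hΦ : Continuous (Function.uncurry Φ))
    {a b : ℝ} (ha : 0 ≤ a) (hb : 0 ≤ b) :
    orderedIntegral k (fun u => orderedIntegral j (fun u' => Φ u u') b) a =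
      ∫ u in {w : Fin k → ℝ | (∀ i, w i ∈ Set.Icc (0 : ℝ) a) ∧ Monotone w},
        ∫ u' in {w : Fin j → ℝ | (∀ i, w i ∈ Set.Icc (0 : ℝ) b) ∧ Monotone w}, Φ u u' := by
  have hinner : ∀ u : Fin k → ℝ, orderedIntegral j (fun u' => Φ u u') b =
      ∫ u' in {w : Fin j → ℝ | (∀ i, w i ∈ Set.Icc (0 : ℝ) b) ∧ Monotone w}, Φ u u' := fun u =>
    orderedIntegral_eq_setIntegral_simplex j _ (hΦ.comp (continuous_const.prodMk continuous_id)) b hb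
  have houter : Continuous fun u : Fin k → ℝ => orderedIntegral j (fun u' => Φ u u') b :=
    continuous_orderedIntegral j Φ hΦ (fun _ => b) continuous_const
  rw [orderedIntegral_eq_setIntegral_simplex k _ houter a ha]
  exact setIntegral_congr_fun (measurableSet_simplex k a) fun u _ => hinner u

/-- **Nested a.e. match ⇒ equal nested set integrals**: if for a.e. `u ∈ S`, for a.e. `u′ ∈ T`, `F u u′ = G u u′`, then
`∫_{u ∈ S} ∫_{u′ ∈ T} F = ∫_{u ∈ S} ∫_{u′ ∈ T} G`. -/
theorem ae_congr_nested_setIntegral {k j : ℕ} {S : Set (Fin k → ℝ)} {T : Set (Fin j → ℝ)} (F G : (Fin k → ℝ) → (Fin j → ℝ) → ℂ)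
    (h : ∀ᵐ u ∂(volume.restrict S), ∀ᵐ u' ∂(volume.restrict T), F u u' = G u u') :
    ∫ u in S, ∫ u' in T, F u u' = ∫ u in S, ∫ u' in T, G u u' := by
  refine integral_congr_ae ?_
  filter_upwards [h] with u hu
  exact integral_congr_ae hu

variable {L : ℕ} [NeZero L]

/-! ### §2 The assembly -/

/-- **(H1) MODULO THE POINTWISE ALGEBRA.**  Let `0 < β`, `0 ≤ s ≤ β`, `Z₀ ≠ 0`, and let `Φ k j : ℝ^k → ℝ^j → ℂ` be jointly continuous densities
whose two-time Dyson series in the variables of `…TwoPointTimeReduction` / k3c5-p1's p484918,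
`Σ_N U^N Σ_{(k,j) ∈ antidiagonal N} I_k(u ↦ I_j(u′ ↦ Φ k j u u′)(s/β))((β−s)/β)` (LITERALLY the variables of p484918), sums to `V`.  If on every
marked piece, for a.e. `u ∈ Δ_k((β−s)/β)` and a.e. `u′ ∈ Δ_j(s/β)`,
`(−β)^{k+j} · (Z₀ · Σ_x D_s(x, β(1 − (u ⧺ ((β−s)/β+u′))))) = Φ k j u u′` (the Grassmann two-point limit determinant at external times `(s,0)`),
then the two-point limit series at external times `(s, 0)` sums to `V / Z₀`:
`HasSum (n ↦ ((−1)ⁿ/n!)·Uⁿ·Σ_x ∫_{[0,β]ⁿ} D_s(x,τ) dτ) (V/Z₀)`. -/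
theorem hasSum_twoPointTime_of_ae_match {β : ℝ} (hβ : 0 < β) (μ U : ℝ) (σ σ' : Fin 2) (xe ye : TorusSite 2 L)
    {s : ℝ} (hs0 : 0 ≤ s) (hsβ : s ≤ β) {Z₀ V : ℂ} (hZ₀ : Z₀ ≠ 0)
    (Φ : (k j : ℕ) → (Fin k → ℝ) → (Fin j → ℝ) → ℂ) (hΦc : ∀ k j, Continuous (Function.uncurry (Φ k j)))
    (hH : HasSum (fun N : ℕ => (U : ℂ) ^ N * ∑ kj ∈ Finset.HasAntidiagonal.antidiagonal N,
      orderedIntegral kj.1 (fun u => orderedIntegral kj.2 (fun u' => Φ kj.1 kj.2 u u') (s / β)) ((β - s) / β)) V)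
    (hmatch : ∀ k j : ℕ,
      ∀ᵐ u ∂(volume.restrict {w : Fin k → ℝ | (∀ i, w i ∈ Set.Icc (0 : ℝ) ((β - s) / β)) ∧ Monotone w}),
        ∀ᵐ u' ∂(volume.restrict {w : Fin j → ℝ | (∀ i, w i ∈ Set.Icc (0 : ℝ) (s / β)) ∧ Monotone w}),
          (-(β : ℂ)) ^ (k + j) * (Z₀ * ∑ x : Fin (k + j) → TorusSite 2 L, (Matrix.of fun i j' : Fin ((k + j) * 2 + 1) =>
          vertexLimitEntry L β μ ((Fin.append x ![xe, ye] : Fin (k + j + 2) → TorusSite 2 L) (twoPointPlusEnum (k + j) σ i).1)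
            ((Fin.append x ![xe, ye] : Fin (k + j + 2) → TorusSite 2 L) (twoPointMinusEnum (k + j) σ' j').1)
            (twoPointPlusEnum (k + j) σ i).2 (twoPointMinusEnum (k + j) σ' j').2
            ((Fin.append (fun a : Fin (k + j) => β * (1 - Fin.append u (fun l => ((β - s) / β) + u' l) a)) ![s, 0] :
                Fin (k + j + 2) → ℝ) (twoPointMinusEnum (k + j) σ' j').1 -
              (Fin.append (fun a : Fin (k + j) => β * (1 - Fin.append u (fun l => ((β - s) / β) + u' l) a)) ![s, 0] :
                Fin (k + j + 2) → ℝ) (twoPointPlusEnum (k + j) σ i).1)).det) = Φ k j u u') :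
    HasSum (fun n : ℕ => ((-1 : ℂ) ^ n * ((n ! : ℂ))⁻¹) * ((U : ℂ) ^ n * ∑ x : Fin n → TorusSite 2 L,
        ∫ τ in Set.Icc (0 : Fin n → ℝ) (fun _ => β), (Matrix.of fun i j : Fin (n * 2 + 1) =>
        vertexLimitEntry L β μ ((Fin.append x ![xe, ye] : Fin (n + 2) → TorusSite 2 L) (twoPointPlusEnum n σ i).1)
          ((Fin.append x ![xe, ye] : Fin (n + 2) → TorusSite 2 L) (twoPointMinusEnum n σ' j).1)
          (twoPointPlusEnum n σ i).2 (twoPointMinusEnum n σ' j).2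
          ((Fin.append τ ![s, 0] : Fin (n + 2) → ℝ) (twoPointMinusEnum n σ' j).1 -
            (Fin.append τ ![s, 0] : Fin (n + 2) → ℝ) (twoPointPlusEnum n σ i).1)).det)) (V / Z₀) := by
  have hβ0 : β ≠ 0 := hβ.ne'
  have h1 : (1 : ℝ) - s / β = (β - s) / β := by field_simp
  have h2 : (1 : ℝ) - (1 - s / β) = s / β := by ring
  have ha : 0 ≤ (β - s) / β := div_nonneg (sub_nonneg.2 hsβ) hβ.le
  have hb : 0 ≤ s / β := div_nonneg hs0 hβ.le
  -- divide the Hamiltonian series by `Z₀`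
  have hH' : HasSum (fun N : ℕ => Z₀⁻¹ * ((U : ℂ) ^ N * ∑ kj ∈ Finset.HasAntidiagonal.antidiagonal N,
      orderedIntegral kj.1 (fun u => orderedIntegral kj.2 (fun u' => Φ kj.1 kj.2 u u') (s / β)) ((β - s) / β))) (V / Z₀) := by
    have h := hH.mul_left Z₀⁻¹
    rwa [← div_eq_inv_mul] at h
  -- per piece: the Hamiltonian nested ordered integral is `(−β)^n Z₀` times the Grassmann nested set integral
  have hpiece : ∀ (n : ℕ) (kj : ℕ × ℕ) (h : kj.1 + kj.2 = n),
      orderedIntegral kj.1 (fun u => orderedIntegral kj.2 (fun u' => Φ kj.1 kj.2 u u') (s / β)) ((β - s) / β) =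
        (-(β : ℂ)) ^ n * (Z₀ *
          ∫ u in {w : Fin kj.1 → ℝ | (∀ i, w i ∈ Set.Icc (0 : ℝ) ((β - s) / β)) ∧ Monotone w},
            ∫ u' in {w : Fin kj.2 → ℝ | (∀ i, w i ∈ Set.Icc (0 : ℝ) (s / β)) ∧ Monotone w},
              ∑ x : Fin n → TorusSite 2 L, (Matrix.of fun i j : Fin (n * 2 + 1) =>
                vertexLimitEntry L β μ ((Fin.append x ![xe, ye] : Fin (n + 2) → TorusSite 2 L) (twoPointPlusEnum n σ i).1)
                  ((Fin.append x ![xe, ye] : Fin (n + 2) → TorusSite 2 L) (twoPointMinusEnum n σ' j).1)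
                  (twoPointPlusEnum n σ i).2 (twoPointMinusEnum n σ' j).2
                  ((Fin.append (fun a : Fin n => β * (1 - Fin.append u (fun l => (β - s) / β + u' l) (Fin.cast h.symm a))) ![s, 0] :
                      Fin (n + 2) → ℝ) (twoPointMinusEnum n σ' j).1 -
                    (Fin.append (fun a : Fin n => β * (1 - Fin.append u (fun l => (β - s) / β + u' l) (Fin.cast h.symm a))) ![s, 0] :
                      Fin (n + 2) → ℝ) (twoPointPlusEnum n σ i).1)).det) := by
    intro n kj h
    obtain ⟨k, j⟩ := kj
    simp only at h ⊢
    subst h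
    simp only [Fin.cast_eq_self]
    rw [orderedIntegral₂_eq_setIntegral₂ (Φ k j) (hΦc k j) ha hb, ← ae_congr_nested_setIntegral _ _ (hmatch k j)]
    simp_rw [integral_const_mul]
  -- termwise identity
  refine hH'.congr_fun fun n => ?_
  rw [twoPointTime_term_eq_sum_marked hβ μ U σ σ' xe ye hs0 hsβ n]
  simp_rw [h2, h1]
  have hsum : ∑ kj ∈ Finset.HasAntidiagonal.antidiagonal n,
      orderedIntegral kj.1 (fun u => orderedIntegral kj.2 (fun u' => Φ kj.1 kj.2 u u') (s / β)) ((β - s) / β) =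
      (-(β : ℂ)) ^ n * (Z₀ * ∑ kj ∈ Finset.HasAntidiagonal.antidiagonal n, if h : kj.1 + kj.2 = n then
        ∫ u in {w : Fin kj.1 → ℝ | (∀ i, w i ∈ Set.Icc (0 : ℝ) ((β - s) / β)) ∧ Monotone w},
          ∫ u' in {w : Fin kj.2 → ℝ | (∀ i, w i ∈ Set.Icc (0 : ℝ) (s / β)) ∧ Monotone w},
            ∑ x : Fin n → TorusSite 2 L, (Matrix.of fun i j : Fin (n * 2 + 1) =>
              vertexLimitEntry L β μ ((Fin.append x ![xe, ye] : Fin (n + 2) → TorusSite 2 L) (twoPointPlusEnum n σ i).1)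
                ((Fin.append x ![xe, ye] : Fin (n + 2) → TorusSite 2 L) (twoPointMinusEnum n σ' j).1)
                (twoPointPlusEnum n σ i).2 (twoPointMinusEnum n σ' j).2
                ((Fin.append (fun a : Fin n => β * (1 - Fin.append u (fun l => (β - s) / β + u' l) (Fin.cast h.symm a))) ![s, 0] :
                    Fin (n + 2) → ℝ) (twoPointMinusEnum n σ' j).1 -
                  (Fin.append (fun a : Fin n => β * (1 - Fin.append u (fun l => (β - s) / β + u' l) (Fin.cast h.symm a))) ![s, 0] :
                    Fin (n + 2) → ℝ) (twoPointPlusEnum n σ i).1)).det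
        else 0) := by
    rw [Finset.mul_sum, Finset.mul_sum]
    refine Finset.sum_congr rfl fun kj hkj => ?_
    have h : kj.1 + kj.2 = n := Finset.HasAntidiagonal.mem_antidiagonal.1 hkj
    rw [dif_pos h, hpiece n kj h]
  rw [hsum]
  field_simp

end

end Summit.HubbardSuperconductivity.HubbardSuperconductivity.Theorems.MatsubaraAllU
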